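import Literature.NumberTheory.Sieve.AletheiaZomleferFukshanskyGarcia2020ApplicationsBrunSieveProofs
import Literature.NumberTheory.Sieve.SieveFrameworkFundamentalLemma
import Summits.Parity.BatemanHorn.Theses.VanishingDimension

/-!
# Route VanishingDimension — support item `RoughTupleBound` (stmt-Parity-18606)

For every Bateman–Horn system `f = (f₁, …, f_k)` and every `θ ∈ (0, 1/4]` there is `C` with

  `#{1 ≤ n ≤ x : no prime p < ⌊x^θ⌋ divides any fᵢ(n)} ≤ C · x / (log x)^k`

for all large `x : ℕ` — the classical upper-bound sieve of dimension `k` on the product sequence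
(Bateman–Horn 1962, (2); Halberstam–Richert, *Sieve Methods*, Thm 2.5 / Thm 5.3), here run
through the tree's PROVED Fundamental Lemma `SieveSequence.fundamental_lemma_uniform_holds` and
the sifted sequence of polynomial values `polyAPSeq`, exactly as in the tree's discharge of the
Brun-sieve bound for `Q(f; x)`
(`AletheiaZomleferFukshanskyGarcia2020ApplicationsBrunSieveProofs.lean`, namespace
`PolyPrimeCountBrun`), whose lemmas are reused:

1. (`roughTuple_card_le_add_card_coprime`) with `n₀` such that `fᵢ(n) ≥ 1` for `n ≥ n₀` and
   `F(t) = ∏ᵢ fᵢ(t + n₀)`, a jointly `y`-rough `n ∈ [1, x]` with `n > n₀` gives `m = n − n₀ ∈ (0, x]`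
   with `(F(m), P(y)) = 1`; hence `#R(x) ≤ n₀ + #{1 ≤ m ≤ x : (F(m), P(y)) = 1}`.
2. `ω_F(p) = ω_f(p) ≤ ∑ deg fᵢ`, `ω_F(p) < p`, so `ω_F(m)/m` has sieve dimension `2∑ deg fᵢ`
   (`PolyPrimeCountBrun.hasSieveDimension_rootDensity_of_le`), and the Fundamental Lemma at level
   `y = ⌊x^θ⌋` (`PolyPrimeCountBrun.card_coprime_le_of_fundamentalLemma`) gives
   `≤ (1 + C_FL) x ∏_{p<y} (1 − ω(p)/p) + y²`.
3. `∏_{p<y} (1 − ω(p)/p) = [Bateman–Horn partial product] · (∏_{p<y} (1 − 1/p))^k ≤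
   2C(f) (2A₁/(θ log x))^k` by the convergence of the partial products to `C(f) > 0`
   (`exists_hasBatemanHornConst_holds`) and Mertens (`Lichtman2020.prod_primesLE_one_sub_inv_le`),
   since `log(y − 1) ≥ (θ/2) log x` once `x^θ ≥ 4`.
4. `n₀ + y² ≤ (n₀ + 1) x^{1/2} ≤ x/(log x)^k` eventually (`θ ≤ 1/4`;
   `roughTuple_eventually_mul_sqrt_le`).

The constant obtained is `C = (1 + C_FL) · 2C(f) · (2A₁/θ)^k + 1`, `A₁ = e^{6/log 2} log 2`.
No definition and no named fact is introduced.
-/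

noncomputable section

open Filter Finset Polynomial
open scoped Topology

namespace Summit.Parity.BatemanHorn.Theorems

open Literature.NumberTheory.Sieve Literature.NumberTheory.Sieve.PolyPrimeCountBrun

/-- **Reduction of the jointly rough set to a sifted set.** For any `n₀` and `F(t) = ∏ᵢ fᵢ(t + n₀)`:
an `n ∈ [1, x]` such that no prime `p < y` divides any `fᵢ(n)` is either `≤ n₀`, or `n = m + n₀`
with `m ∈ (0, x]` and `(F(m), P(y)) = 1` (a prime `q < y` dividing `|F(m)| = |∏ fᵢ(n)|` divides some
`fᵢ(n)`). Hence `#R ≤ n₀ + #{m ∈ (0, x] : (F(m), P(y)) = 1}`. [folklore] -/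
theorem roughTuple_card_le_add_card_coprime {k : ℕ} (f : Fin k → ℤ[X]) (n₀ x y : ℕ) :
    #((Icc 1 x).filter fun n : ℕ =>
        ∀ i, ∀ p ∈ range y, p.Prime → ¬ ((p : ℤ) ∣ (f i).eval (n : ℤ))) ≤
      n₀ + #((Ioc 0 x).filter fun m : ℕ =>
        (((∏ i, f i).comp (X + C (n₀ : ℤ))).eval (m : ℤ)).natAbs.Coprime
          (primesProdBelow (y : ℝ))) := by
  classical
  set F := (∏ i, f i).comp (X + C (n₀ : ℤ)) with hF
  have hFeval : ∀ m : ℕ, F.eval (m : ℤ) = ∏ i, (f i).eval ((m : ℤ) + n₀) := fun m => by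
    simp [hF, eval_comp, eval_prod]
  set R := (Icc 1 x).filter fun n : ℕ =>
    ∀ i, ∀ p ∈ range y, p.Prime → ¬ ((p : ℤ) ∣ (f i).eval (n : ℤ)) with hR
  set T₁ := (Ioc 0 x).filter fun m : ℕ =>
    (F.eval (m : ℤ)).natAbs.Coprime (primesProdBelow (y : ℝ)) with hT₁
  have hsub : R ⊆ Icc 1 n₀ ∪ T₁.image (· + n₀) := by
    intro n hn
    rw [hR, mem_filter, mem_Icc] at hn
    obtain ⟨⟨hn1, hnx⟩, hrough⟩ := hn
    rw [mem_union]
    by_cases hnn : n ≤ n₀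
    · exact Or.inl (mem_Icc.mpr ⟨hn1, hnn⟩)
    · right
      have hlt : n₀ < n := not_le.mp hnn
      rw [mem_image]
      refine ⟨n - n₀, ?_, Nat.sub_add_cancel hlt.le⟩
      rw [hT₁, mem_filter, mem_Ioc]
      refine ⟨⟨by omega, by omega⟩, ?_⟩
      rw [coprime_primesProdBelow_iff, Nat.ceil_natCast]
      intro q hq hqd
      rw [Nat.mem_primesBelow] at hq
      have hcast : ((n - n₀ : ℕ) : ℤ) + n₀ = n := by
        rw [Nat.cast_sub hlt.le]
        ring
      have hqd' : (q : ℤ) ∣ F.eval ((n - n₀ : ℕ) : ℤ) := Int.natCast_dvd.mpr hqd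
      rw [hFeval, hcast] at hqd'
      obtain ⟨i, -, hi⟩ :=
        (Prime.dvd_finsetProd_iff (Nat.prime_iff_prime_int.mp hq.2) _).mp hqd'
      exact hrough i q (mem_range.mpr hq.1) hq.2 hi
  calc #R ≤ #(Icc 1 n₀ ∪ T₁.image (· + n₀)) := card_le_card hsub
    _ ≤ #(Icc 1 n₀) + #(T₁.image (· + n₀)) := card_union_le _ _
    _ ≤ n₀ + #T₁ := by
        rw [Nat.card_Icc, Nat.add_sub_cancel]
        exact Nat.add_le_add_left card_image_le _

/-- `Kf · N^{1/2} ≤ N/(log N)^k` for all large `N : ℕ` (`(log N)^k = o(N^{1/2})`,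
`isLittleO_log_rpow_rpow_atTop`). [folklore] -/
theorem roughTuple_eventually_mul_sqrt_le (Kf : ℝ) (k : ℕ) :
    ∀ᶠ N : ℕ in atTop, Kf * (N : ℝ) ^ (1 / 2 : ℝ) ≤ (N : ℝ) / Real.log N ^ k := by
  set K' : ℝ := max Kf 1 with hK'
  have hK'0 : 0 < K' := lt_of_lt_of_le zero_lt_one (le_max_right _ _)
  have hKK' : Kf ≤ K' := le_max_left _ _
  have hlo := isLittleO_log_rpow_rpow_atTop (k : ℝ) (by norm_num : (0 : ℝ) < 1 / 2)
  have hev := hlo.def (inv_pos.mpr hK'0)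
  have hreal : ∀ᶠ x : ℝ in atTop, Kf * x ^ (1 / 2 : ℝ) ≤ x / Real.log x ^ k := by
    filter_upwards [hev, eventually_gt_atTop (1 : ℝ)] with x hx hx1
    have hx0 : 0 < x := by linarith
    have hlog : 0 < Real.log x := Real.log_pos hx1
    rw [Real.norm_of_nonneg (Real.rpow_nonneg hlog.le _),
      Real.norm_of_nonneg (Real.rpow_nonneg hx0.le _), Real.rpow_natCast] at hx
    have hsq : x ^ (1 / 2 : ℝ) * x ^ (1 / 2 : ℝ) = x := by
      rw [← Real.rpow_add hx0]; norm_num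
    have hxhalf : 0 ≤ x ^ (1 / 2 : ℝ) := Real.rpow_nonneg hx0.le _
    have h1 : K' * Real.log x ^ k ≤ x ^ (1 / 2 : ℝ) := by
      have := mul_le_mul_of_nonneg_left hx hK'0.le
      rwa [← mul_assoc, mul_inv_cancel₀ hK'0.ne', one_mul] at this
    rw [le_div_iff₀ (pow_pos hlog k)]
    calc Kf * x ^ (1 / 2 : ℝ) * Real.log x ^ k ≤ K' * x ^ (1 / 2 : ℝ) * Real.log x ^ k :=
          mul_le_mul_of_nonneg_right (mul_le_mul_of_nonneg_right hKK' hxhalf) (pow_nonneg hlog.le k)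
      _ = x ^ (1 / 2 : ℝ) * (K' * Real.log x ^ k) := by ring
      _ ≤ x ^ (1 / 2 : ℝ) * x ^ (1 / 2 : ℝ) := mul_le_mul_of_nonneg_left h1 hxhalf
      _ = x := hsq
  exact tendsto_natCast_atTop_atTop.eventually hreal

/-- **Support item `RoughTupleBound` of route VanishingDimension (stmt-Parity-18606).** For every
Bateman–Horn system `f` of `k` polynomials and every `θ ∈ (0, 1/4]` there is `C` such that, for all
large `x : ℕ`, the number of `1 ≤ n ≤ x` for which no prime `p < ⌊x^θ⌋` divides any `fᵢ(n)` is at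
most `C · x/(log x)^k` (upper-bound sieve of dimension `k` on the product sequence at level `x^θ`:
Fundamental Lemma + convergence of the Bateman–Horn product + Mertens; Bateman–Horn 1962 (2),
Halberstam–Richert Thm 5.3). -/
theorem vanishingDimension_roughTupleBound_proof :
    Summit.Parity.BatemanHorn.Theses.VanishingDimension.RoughTupleBound := by
  unfold Summit.Parity.BatemanHorn.Theses.VanishingDimension.RoughTupleBound
  intro k f hf θ hθ hθ4
  classical
  -- constants depending on `f` (and `θ`) only
  set D : ℕ := ∑ i, (f i).natDegree with hD
  set κ : ℝ := 2 * (D : ℝ) with hκ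
  set K : ℝ := ((2 * D + 1 : ℕ) : ℝ) ^ (2 * D + 1) * Real.exp (2 * D * (9 / 2 + 6 / Real.log 2))
    with hK
  obtain ⟨CFL, hCFL0, hFL⟩ := SieveSequence.fundamental_lemma_uniform_holds κ K
  set A₁ : ℝ := Real.exp (6 / Real.log 2) * Real.log 2 with hA₁
  have hA₁0 : 0 < A₁ := by rw [hA₁]; exact mul_pos (Real.exp_pos _) (Real.log_pos one_lt_two)
  obtain ⟨Cf, hCfpos, hCf⟩ := exists_hasBatemanHornConst_holds (ι := Fin k) hf
  have hdpos : ∀ i, 0 < (f i).natDegree := hf.natDegree_pos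
  -- `n₀`: all `fᵢ(n) ≥ 1` for `n ≥ n₀`
  have hn₀i : ∀ i, ∃ N₀ : ℕ, ∀ n : ℕ, N₀ ≤ n → 1 ≤ (f i).eval (n : ℤ) := by
    intro i
    obtain ⟨N₀, hN₀⟩ := Literature.Barriers.Parity.exists_forall_le_eval_of_leadingCoeff_pos
      (hdpos i) (hf.leadingCoeff_pos i) 1
    exact ⟨N₀, fun n hn => by exact_mod_cast hN₀ n hn⟩
  choose N₀ hN₀ using hn₀i
  set n₀ : ℕ := Finset.univ.sup N₀ with hn₀_def
  have hn₀ : ∀ i, ∀ n : ℕ, n₀ ≤ n → 1 ≤ (f i).eval (n : ℤ) := fun i n hn =>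
    hN₀ i n ((Finset.le_sup (f := N₀) (mem_univ i)).trans hn)
  -- the shifted product polynomial
  obtain ⟨F, hF⟩ : ∃ F : ℤ[X], F = (∏ i, f i).comp (X + Polynomial.C (n₀ : ℤ)) := ⟨_, rfl⟩
  have hFeval : ∀ m : ℕ, F.eval (m : ℤ) = ∏ i, (f i).eval ((m : ℤ) + n₀) := fun m => by
    simp [hF, eval_comp, eval_prod]
  have hρF : ∀ p, polyRootCountMod ![F] p = polyRootCountMod f p := fun p => by
    rw [hF, Literature.Barriers.Parity.polyRootCountMod_comp_X_add_C,
      ← polyRootCountMod_eq_single_prod]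
  have hρlt : ∀ p, p.Prime → polyRootCountMod ![F] p < p := fun p hp => by
    rw [hρF]; exact hf.hasNoFixedPrimeDivisor p hp
  have hρle : ∀ p, p.Prime → polyRootCountMod ![F] p ≤ D := fun p hp => by
    rw [hρF p, polyRootCountMod_eq_single_prod]
    refine (polyRootCountMod_single_le_natDegree_of_lt hp ?_).trans ?_
    · rw [← polyRootCountMod_eq_single_prod]; exact hf.hasNoFixedPrimeDivisor p hp
    · exact natDegree_prod_le _ _
  have hdim : HasSieveDimension (rootDensity F) κ K := hasSieveDimension_rootDensity_of_le hρle hρlt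
  have hFpos : ∀ m : ℕ, 0 < m → 0 < F.eval (m : ℤ) := fun m _ => by
    rw [hFeval]
    exact prod_pos fun i _ => by
      have := hn₀ i (m + n₀) (Nat.le_add_left _ _)
      push_cast at this
      linarith
  -- the constant
  refine ⟨(1 + CFL) * (2 * Cf) * (2 * A₁ / θ) ^ k + 1, ?_⟩
  -- eventualities in `x`
  have hyt : Tendsto (fun x : ℕ => ⌊(x : ℝ) ^ θ⌋₊ - 1) atTop atTop :=
    (tendsto_sub_atTop_nat 1).comp (tendsto_nat_floor_atTop.comp
      ((tendsto_rpow_atTop hθ).comp tendsto_natCast_atTop_atTop))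
  have E1 : ∀ᶠ x : ℕ in atTop, batemanHornPartial f (⌊(x : ℝ) ^ θ⌋₊ - 1) ≤ 2 * Cf := by
    have h2C : ∀ᶠ y : ℕ in atTop, batemanHornPartial f y < 2 * Cf :=
      hCf.eventually (gt_mem_nhds (by linarith))
    exact (hyt.eventually h2C).mono fun x h => h.le
  have E2 : ∀ᶠ x : ℕ in atTop, (4 : ℝ) ≤ (x : ℝ) ^ θ :=
    ((tendsto_rpow_atTop hθ).comp tendsto_natCast_atTop_atTop).eventually (eventually_ge_atTop 4)
  have E3 := roughTuple_eventually_mul_sqrt_le ((n₀ : ℝ) + 1) k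
  filter_upwards [E1, E2, E3, eventually_ge_atTop (2 : ℕ)] with x h1 h2 h3 hx2
  -- parameters at height `x`
  have hx0 : (0 : ℝ) < x := by exact_mod_cast (by omega : 0 < x)
  have hx1 : (1 : ℝ) < x := by exact_mod_cast (by omega : 1 < x)
  have hθ0 : θ ≠ 0 := hθ.ne'
  have hxθ0 : (0 : ℝ) < (x : ℝ) ^ θ := Real.rpow_pos_of_pos hx0 θ
  set y : ℕ := ⌊(x : ℝ) ^ θ⌋₊ with hy
  have hy4 : 4 ≤ y := Nat.le_floor (by exact_mod_cast h2)
  set y' : ℕ := y - 1 with hy'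
  have hyy' : y = y' + 1 := by omega
  have hy'2 : 2 ≤ y' := by omega
  have hyle : (y : ℝ) ≤ (x : ℝ) ^ θ := by rw [hy]; exact Nat.floor_le hxθ0.le
  have hylt : (x : ℝ) ^ θ < (y : ℝ) + 1 := by rw [hy]; exact Nat.lt_floor_add_one _
  have hyy'r : (y : ℝ) = (y' : ℝ) + 1 := by rw [hyy']; push_cast; ring
  have hay' : (x : ℝ) ^ θ / 2 ≤ (y' : ℝ) := by linarith
  have hz2 : (2 : ℝ) ≤ (y : ℝ) := by exact_mod_cast (by omega : 2 ≤ y)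
  -- logarithms
  have hlogx : 0 < Real.log x := Real.log_pos hx1
  have hlog0 : Real.log x ≠ 0 := hlogx.ne'
  have hloga : Real.log ((x : ℝ) ^ θ) = θ * Real.log x := Real.log_rpow hx0 θ
  have hlog4 : Real.log 4 = 2 * Real.log 2 := by
    rw [show (4 : ℝ) = 2 ^ 2 by norm_num, Real.log_pow]; norm_num
  have hlog2a : 2 * Real.log 2 ≤ θ * Real.log x := by
    rw [← hlog4, ← hloga]; exact Real.log_le_log (by norm_num) h2
  have hlogy' : θ * Real.log x / 2 ≤ Real.log y' := by
    calc θ * Real.log x / 2 ≤ θ * Real.log x - Real.log 2 := by linarith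
      _ = Real.log ((x : ℝ) ^ θ / 2) := by rw [Real.log_div hxθ0.ne' (by norm_num), hloga]
      _ ≤ Real.log y' := Real.log_le_log (by positivity) hay'
  have hθlog : 0 < θ * Real.log x / 2 := by positivity
  -- Mertens
  set M : ℝ := ∏ p ∈ Nat.primesLE y', (1 - 1 / (p : ℝ)) with hM
  have hM0 : 0 ≤ M := prod_nonneg fun p hp => by
    have : (2 : ℝ) ≤ p := by exact_mod_cast (Nat.prime_of_mem_primesLE hp).two_le
    have : (1 : ℝ) / p ≤ 1 / 2 := one_div_le_one_div_of_le (by norm_num) this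
    linarith
  have hMle : M ≤ (2 * A₁ / θ) / Real.log x := by
    calc M ≤ Real.exp (6 / Real.log 2) * (Real.log 2 / Real.log y') :=
          Lichtman2020.prod_primesLE_one_sub_inv_le hy'2
      _ = A₁ / Real.log y' := by rw [hA₁]; ring
      _ ≤ A₁ / (θ * Real.log x / 2) := div_le_div_of_nonneg_left hA₁0.le hθlog hlogy'
      _ = (2 * A₁ / θ) / Real.log x := by field_simp
  -- the sieve product `V(y)`
  have hceil : ⌈((y : ℕ) : ℝ)⌉₊ = y' + 1 := by rw [Nat.ceil_natCast, hyy']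
  have hVeq : ∏ p ∈ Nat.primesBelow ⌈((y : ℕ) : ℝ)⌉₊, (1 - (polyRootCountMod ![F] p : ℝ) / p) =
      batemanHornPartial f y' * M ^ k := by
    rw [hceil]
    change ∏ p ∈ Nat.primesLE y', (1 - (polyRootCountMod ![F] p : ℝ) / p) = _
    simp_rw [hρF]
    exact prod_one_sub_rootCount_eq f y'
  have hV : ∏ p ∈ Nat.primesBelow ⌈((y : ℕ) : ℝ)⌉₊, (1 - (polyRootCountMod ![F] p : ℝ) / p) ≤
      2 * Cf * ((2 * A₁ / θ) ^ k / Real.log x ^ k) := by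
    rw [hVeq]
    have hMk : M ^ k ≤ ((2 * A₁ / θ) / Real.log x) ^ k := pow_le_pow_left₀ hM0 hMle k
    rw [div_pow] at hMk
    exact mul_le_mul h1 hMk (pow_nonneg hM0 k) (by positivity)
  -- sieve and reduction
  have hS := card_coprime_le_of_fundamentalLemma hCFL0.le hFL hdim hFpos x hz2
  have hR := roughTuple_card_le_add_card_coprime f n₀ x y
  rw [← hF] at hR
  have hRr := (Nat.cast_le (α := ℝ)).mpr hR
  rw [Nat.cast_add] at hRr
  have hCx : (0 : ℝ) ≤ (1 + CFL) * (x : ℝ) := by positivity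
  have hT₁ := hS.trans (add_le_add (mul_le_mul_of_nonneg_left hV hCx) (le_refl ((y : ℝ) ^ 2)))
  -- lower-order terms
  have hlow : (n₀ : ℝ) + (y : ℝ) ^ 2 ≤ ((n₀ : ℝ) + 1) * (x : ℝ) ^ (1 / 2 : ℝ) := by
    have hz_le : (y : ℝ) ≤ (x : ℝ) ^ (1 / 4 : ℝ) :=
      hyle.trans (Real.rpow_le_rpow_of_exponent_le hx1.le hθ4)
    have hsq : ((x : ℝ) ^ (1 / 4 : ℝ)) ^ 2 = (x : ℝ) ^ (1 / 2 : ℝ) := by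
      rw [← Real.rpow_natCast, ← Real.rpow_mul hx0.le]; norm_num
    have hz2' : (y : ℝ) ^ 2 ≤ (x : ℝ) ^ (1 / 2 : ℝ) := by
      rw [← hsq]; exact pow_le_pow_left₀ (by positivity) hz_le 2
    have hone : (1 : ℝ) ≤ (x : ℝ) ^ (1 / 2 : ℝ) := Real.one_le_rpow hx1.le (by norm_num)
    have hn0 : (0 : ℝ) ≤ n₀ := Nat.cast_nonneg _
    nlinarith
  -- assembly
  calc _ ≤ _ := hRr
    _ ≤ (n₀ : ℝ) + ((1 + CFL) * x * (2 * Cf * ((2 * A₁ / θ) ^ k / Real.log x ^ k)) +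
          (y : ℝ) ^ 2) := add_le_add le_rfl hT₁
    _ = (1 + CFL) * (2 * Cf) * (2 * A₁ / θ) ^ k * ((x : ℝ) / Real.log x ^ k) +
          ((n₀ : ℝ) + (y : ℝ) ^ 2) := by ring
    _ ≤ (1 + CFL) * (2 * Cf) * (2 * A₁ / θ) ^ k * ((x : ℝ) / Real.log x ^ k) +
          (x : ℝ) / Real.log x ^ k := add_le_add le_rfl (hlow.trans h3)
    _ = ((1 + CFL) * (2 * Cf) * (2 * A₁ / θ) ^ k + 1) * (x : ℝ) / Real.log x ^ k := by ring

end Summit.Parity.BatemanHorn.Theorems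

end
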